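import Summits.ResolutionOfSingularities.ResolutionOfSingularities.Theorems.SpreadCutLaw2
import HarnessLib

/-!
# SpreadCutLaw3 — decomp-res node «SpreadCut» (lens-2 g19), file 3/4 of `SpreadCutLaw`

Content VERBATIM from the decomp-res lens-2 g19 node `HOME/decomp-res-lens-2/g19/SpreadCut.lean` (pin b2959d31, 3
579 l; HOME = run/shared/lean/pub/decomp-res);
CRITIC-LEDGER row 155 (DECIDED-MOD-PORT +1); landing orders INBOX :540: l. 143–2878 are `CylinderCut` d60dded1
VERBATIM (landed as `CylinderCutClasses` · `CylinderCutCells` ·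
`MaxContactCutCylinderCut`) and are DELETED here with the landed modules imported instead (namespaces
`…Theorems.PinchCut` / `JetCut` / `PurityCut` / `SplitCut` / `CylinderCut`
opened; same short names, byte-identical bodies — never two copies); NEW = §Γ (l. 2880–3336, the ring-level law +
§Γ.3 point level) and §V (l. 3338–3576, the spread cut).
Namespace `…Theorems.SpreadCut` (the lens's `Theses.SpreadCut` is gate-reserved), sub-namespace `Spread` as in the
lens; file split only (tree files ≤ 400 lines): sections,
variables, the `open MvPolynomial` lines and every declaration exactly as in the lens; the node's global
dupNamespace-linter line dropped.  Node files, in import order: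
`SpreadCutLaw` (§Γ + the cone-free head of §V; continued `…2` / `…3` where the cap cuts) · `SpreadCutCells` (§V2–§V4
cone-free: the aside home) · the wiring `MaxContactCutSpreadCut`
(§V BY NAME on the host route, in the Theses cone).  All `--supports stmt-ResolutionOfSingularities-29273`
(`MaxContactCut.RungOne`); nothing closes 29273 — decided halves
carry their engines as hypotheses (`SpreadExit` is a paper engine, not an item); exactly ONE located-residual aside
on the lens-2 column (`Spread.SpreadSpecialRung`, home
`SpreadCutCells`) SUPERSEDES g18's `Cyl.CylSpecialRung`, re-located EXACTLY modulo the spread decided half.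

§Γ (NEW, g19): LAW (Γ) — THE SECONDARY CURVE OF THE TOP CURVE read over `𝒪_C`, ring level: `binForm`, `lowerChart` /
`upperChart`, `RelSimple`, `SpreadShape` + kernels and the INSEP-v certificates (needs the tree's
`DeltaFaceCutClasses.qWeighted`); §Γ.3 point / curve level: `IsSpreadAt`, `IsUniformSpreadCurve`, the ENGINE `def
SpreadExit : Prop` (a paper engine: hypothesis, not an item), `IsSpreadCurvePt`, the decided class; and the
cone-free head of §V (`spreadLeaf = cylLeaf ∨ (Γ)` + order lemmas, the located residual class `IsSpreadSpecialPt` +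
iffs).  PROVED kernels, VERBATIM; continued `…2` where the 400-line cap cuts.

Part 3/4 carries: `lowerChart_pureCoeff`, `upperChart_pureCoeff`, `spreadShape_pure`, `insepV`, `insepV3`,
`represent_INSEPv`, `insepV_census`, `represent_INSEPv3`, `insepV3_coeff_mem_sq`, `IsSpreadAt`,
`IsUniformSpreadCurve`, `SpreadExit`, `IsSpreadCurvePt`, `isCurveExitPt_of_isSpreadCurvePt`, `le_of_isSpreadAt`,
`spreadLeaf`, `cylLeaf_le_spreadLeaf`, `splitLeaf_le_spreadLeaf`, `grandLeaf_le_spreadLeaf`,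
`vastLeaf_le_spreadLeaf`, `pinchLeaf_le_spreadLeaf`, `spreadLeaf_of_isSpreadCurvePt`, `IsSpreadSpecialPt`.

(Sources: Hironaka1964 Ch. III; CossartJannsenSaito2020 Ch. 2, Ch. 8–9; CossartPiltant2008 Prop. 4.2;
CossartPiltant2019 Rem. 3.2; BierstoneGrigorievMilmanWlodarczyk2011 §3.1; Moh1987; Hauser2010Kangaroo; Giraud1975;
Narasimhan1983.)
-/

open CategoryTheory AlgebraicGeometry TopologicalSpace IsLocalRing
open Literature.AlgebraicGeometry.Resolution
open Summit.ResolutionOfSingularities.ResolutionOfSingularities.Theorems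
open Summit.ResolutionOfSingularities.ResolutionOfSingularities.Theorems.WeakOrderReduction
open Summit.ResolutionOfSingularities.ResolutionOfSingularities.Theorems.DeltaFaceCutClasses
open Summit.ResolutionOfSingularities.ResolutionOfSingularities.Theorems.RelativeDeltaCut
open Summit.ResolutionOfSingularities.ResolutionOfSingularities.Theorems.CurveLeafExit
open Summit.ResolutionOfSingularities.ResolutionOfSingularities.Theorems.PinchCut
open Summit.ResolutionOfSingularities.ResolutionOfSingularities.Theorems.JetCut
open Summit.ResolutionOfSingularities.ResolutionOfSingularities.Theorems.PurityCut
open Summit.ResolutionOfSingularities.ResolutionOfSingularities.Theorems.SplitCut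
open Summit.ResolutionOfSingularities.ResolutionOfSingularities.Theorems.CylinderCut
open MvPolynomial

namespace Summit.ResolutionOfSingularities.ResolutionOfSingularities.Theorems.SpreadCut

section SpreadRing

variable {R : Type} [CommRing R]

section SpreadKernel

/-- The lower chart of the pure form is `X^m + C a`.  KERNEL (PROVED). [folklore] -/
theorem lowerChart_pureCoeff (a : R) {m : ℕ} (hm : m ≠ 0) :
    lowerChart (pureCoeff a m) m = Polynomial.X ^ m + Polynomial.C a := by
  unfold lowerChart
  rw [Finset.sum_eq_add_of_mem m 0 (by simp) (by simp) hm]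
  · simp [pureCoeff, hm.symm]
  · intro c _ hc
    simp [pureCoeff, hc.1, hc.2]

/-- The upper chart of the pure form is `1 + C a · X^m`.  KERNEL (PROVED). [folklore] -/
theorem upperChart_pureCoeff (a : R) {m : ℕ} (hm : m ≠ 0) :
    upperChart (pureCoeff a m) m = 1 + Polynomial.C a * Polynomial.X ^ m := by
  unfold upperChart
  rw [Finset.sum_eq_add_of_mem m 0 (by simp) (by simp) hm]
  · simp [pureCoeff, hm.symm]
  · intro c _ hc
    simp [pureCoeff, hc.1, hc.2]

/-- **RING-LEVEL SHAPE CERTIFICATE AT A JUMP POINT** [g19; KERNEL (PROVED)]: `f = zⁿ + (u₁^m + a·u₂^m) + g` with the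
tail above the face,
`m + 1 = (q+1)n`, `q ≥ 1`, and `a ∈ 𝔪 ∖ (𝔪² + 𝔭)` (`ā` a uniformiser of `𝒪_{C,y}`) HAS SPREAD SHAPE — both
regularity letters are
DISCHARGED by `relSimple_X_pow_add_C` / `relSimple_of_sub_one_mem`.  The core of INSEP-v is the instance `n = 2`, `m
= 5`, `q = 2`,
`a = v`, `g = u₂⁷` over `R = 𝒪_{𝔸⁴,0}` (NODE-g19 §3; the polynomial identity is `represent_INSEPv`). [folklore] -/
theorem spreadShape_pure {P M : Ideal R} (hM : M.IsMaximal) (c : Fin 3 → R) {a g f : R} {n m q : ℕ} (hm : m ≠ 0)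
    (hq : 1 ≤ q) (hmn : m + 1 = (q + 1) * n) (hf : f = c 0 ^ n + (c 1 ^ m + a * c 2 ^ m) + g)
    (hg : g ∈ qWeighted c m n (m * n + 1)) (haM : a ∈ M) (ha : a ∉ M ^ 2 ⊔ P) :
    SpreadShape P M c (pureCoeff a m) g f n m := by
  refine ⟨by rw [binForm_pureCoeff _ _ _ hm, hf], hg, ⟨q, hq, hmn⟩, ?_, ?_⟩
  · rw [lowerChart_pureCoeff a hm]
    exact relSimple_X_pow_add_C hM hm haM ha
  · rw [upperChart_pureCoeff a hm]
    refine relSimple_of_sub_one_mem P M _ ?_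
    rw [add_sub_cancel_left]
    exact Ideal.mul_mem_right _ _ (Ideal.mem_map_of_mem _ haM)

end SpreadKernel

end SpreadRing

section InsepVKernel

open MvPolynomial

/-- **THE RESIDUAL's OLD INHABITANT, NOW DECIDED** [g19]: INSEP-v = `(z + v(u₁+u₂))² + u₁⁵ + v·u₂⁵ + u₂⁷ ∈ 𝔽₂[z, v,
u₁, u₂]` (variables
`0, 1, 2, 3`; NODE-g18 §3(c): cyl-special by the slice invariant ν = 1 at the core, 5 elsewhere).  DEFINITION
(support, the bed). [folklore] -/
noncomputable def insepV : MvPolynomial (Fin 4) (ZMod 2) :=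
  (X 0 + X 1 * (X 2 + X 3)) ^ 2 + X 2 ^ 5 + X 1 * X 3 ^ 5 + X 3 ^ 7

/-- **THE NEW RESIDUAL INHABITANT** [g19]: INSEP-v³ = `(z + v(u₁+u₂))² + u₁⁵ + v³·u₂⁵ + u₂⁷` — its secondary curve
`w⁵ + v̄³ = 0` is
the `(3,5)`-CUSP (NODE-g19 §4: `Top(I,2) = C`, cyl-special verbatim, spread-special for EVERY frame by the canonical
tower invariant).
DEFINITION (support, the bed). [folklore] -/
noncomputable def insepV3 : MvPolynomial (Fin 4) (ZMod 2) :=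
  (X 0 + X 1 * (X 2 + X 3)) ^ 2 + X 2 ^ 5 + X 1 ^ 3 * X 3 ^ 5 + X 3 ^ 7

/-- **INSEP-v IN SPREAD PRESENTATION** [g19; KERNEL (PROVED)]: in the frame `z′ = z + v(u₁+u₂)` (g18 `insepFrame`, an involutive
automorphism), INSEP-v `= z′² + binForm u₁ u₂ (pureCoeff v 5) 5 + u₂⁷` — corner `z′²`, PURE secondary form `u₁⁵ +
v·u₂⁵` of degree
`m = 5 = 2·2 + 1` (`q = 2`), tail `u₂⁷` of weight `2·7 = 14 ≥ mn + 1 = 11`. [folklore] -/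
theorem represent_INSEPv :
    insepV = (X 0 + X 1 * (X 2 + X 3)) ^ 2 + binForm (X 2) (X 3) (pureCoeff (X 1) 5) 5 + X 3 ^ 7 := by
  rw [binForm_pureCoeff _ _ _ (by norm_num)]
  simp only [insepV]
  ring

/-- **THE CENSUS FORM of INSEP-v IS THE SQUARE** [g19; KERNEL (PROVED), characteristic 2]: `z² + v²(u₁+u₂)² + u₁⁵ +
v·u₂⁵ + u₂⁷ = INSEP-v`.
[folklore] -/
theorem insepV_census :
    (X 0 : MvPolynomial (Fin 4) (ZMod 2)) ^ 2 + X 1 ^ 2 * (X 2 + X 3) ^ 2 + X 2 ^ 5 + X 1 * X 3 ^ 5 + X 3 ^ 7 = insepV := by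
  have h2 : (2 : MvPolynomial (Fin 4) (ZMod 2)) = 0 := by
    simpa using CharP.cast_eq_zero (MvPolynomial (Fin 4) (ZMod 2)) 2
  simp only [insepV]
  linear_combination (-(X 0 * X 1 * (X 2 + X 3) : MvPolynomial (Fin 4) (ZMod 2))) * h2

/-- **INSEP-v³ IN SPREAD PRESENTATION** [g19; KERNEL (PROVED)]: the SAME corner, degree and tail as INSEP-v, pure secondary form
`u₁⁵ + v³·u₂⁵` — but its moving coefficient `a = v³` lies in `𝔪²`: the core test FAILS in this frame
(`not_relSimple_X_pow_add_C_of_mem_sq`)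
and in every frame (NODE-g19 §4). [folklore] -/
theorem represent_INSEPv3 :
    insepV3 = (X 0 + X 1 * (X 2 + X 3)) ^ 2 + binForm (X 2) (X 3) (pureCoeff (X 1 ^ 3) 5) 5 + X 3 ^ 7 := by
  rw [binForm_pureCoeff _ _ _ (by norm_num)]
  simp only [insepV3]
  ring

/-- The moving coefficient `v³` of INSEP-v³ lies in the SQUARE of the ideal `(z, v, u₁, u₂)` of the origin (hence in
`𝔪²` of the local
ring) — the hypothesis of the negative kernel `not_relSimple_X_pow_add_C_of_mem_sq`.  KERNEL (PROVED). [folklore] -/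
theorem insepV3_coeff_mem_sq :
    (X 1 : MvPolynomial (Fin 4) (ZMod 2)) ^ 3 ∈ (Ideal.span (Set.range (X : Fin 4 → MvPolynomial (Fin 4) (ZMod 2)))) ^ 2 := by
  rw [show (X 1 : MvPolynomial (Fin 4) (ZMod 2)) ^ 3 = X 1 * X 1 ^ 2 by ring]
  apply Ideal.mul_mem_left
  apply Ideal.pow_mem_pow
  exact Ideal.subset_span (Set.mem_range_self 1)

end InsepVKernel

/-! ### §Γ.3  point / curve level — the spread class (Γ), its engine, the decided class -/

/-- **SPREAD-SHAPED at `y` transversal to `η` with degree `m`** [g19] (`IsSpreadAt I n m η y`): regular parameters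
`c = (z, u₁, u₂)` of
`𝒪_{Y,y}` generating the curve prime `curvePrime (η ⤳ y)`, an inert parameter `v` completing them to a minimal system of `𝔪_y`
(`spanFinrank = 4`: the dimension-four frame, the curve regular at `y`), a member `f ∈ I_y` of SPREAD SHAPE
(`SpreadShape (curvePrime h) 𝔪_y
c G g f n m`: corner `zⁿ`, `C`-relative face a binary form of degree `m` with coefficients in `𝒪_{Y,y}`, tail above the face,
`m + 1 = (q+1)n`, secondary curve regular over `y`), and the whole ideal δ-deep: `I_y ⊆ Q(mn)`.  `I_y` need NOT be principal.
DEFINITION (NEW class predicate). (Sources: Hironaka1967; CossartJannsenSaito2020 Ch. 8; CossartPiltant2008 Prop. 4.2.) -/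
def IsSpreadAt {Y : Scheme.{0}} (I : Y.IdealSheafData) (n m : ℕ) (η y : Y) : Prop :=
  ∃ h : η ⤳ y, ∃ (c : Fin 3 → Y.presheaf.stalk y) (v g f : Y.presheaf.stalk y) (G : ℕ → Y.presheaf.stalk y),
    Ideal.span (Set.range c) = curvePrime h ∧
      Ideal.span (Set.range c ∪ {v}) = maximalIdeal (Y.presheaf.stalk y) ∧
      (maximalIdeal (Y.presheaf.stalk y)).spanFinrank = 4 ∧
      f ∈ stalkIdeal I y ∧ stalkIdeal I y ≤ qWeighted c m n (m * n) ∧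
      SpreadShape (curvePrime h) (maximalIdeal (Y.presheaf.stalk y)) c G g f n m

/-- **UNIFORMLY SPREAD-SHAPED CURVE of degree `m`** [g19] (`IsUniformSpreadCurve I n m η`): `η` is a curve point and
EVERY closed point of
`closure {η}` is spread-shaped transversal to `η` with the SAME `(n, m)` (frames, forms and tails vary with the
point; at the jump points
the multiple roots of the residue face move transversally, elsewhere the residue face may be squarefree).  The
hypothesis of ENGINE (Γ).
DEFINITION (NEW class predicate). -/
def IsUniformSpreadCurve {Y : Scheme.{0}} (I : Y.IdealSheafData) (n m : ℕ) (η : Y) : Prop :=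
  IsCurvePt η ∧ ∀ y : Y, η ⤳ y → IsClosed ({y} : Set Y) → IsSpreadAt I n m η y

/-- **ENGINE (Γ) `SpreadExit`** [g19; DECIDED · paper proof = module docstring §Γ.1 (the tower `C, Σ₁, …, Σ_{q−1}`
of `ℙ¹`-bundle sections
by the weight bookkeeping `e_j = |α| + j(i − n)`; location `Top(I_j, n) ∩ π⁻¹C = Σ_j`; at stage `q` the top locus
over `C` lies on the
SECONDARY CURVE `Γ ≅ V(Φ̄) ⊂ ℙ¹_{𝒪_C}`, whose regularity makes `(z_q, u, F̃)` regular parameters, so `in_n f_q =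
B(Z,U) + U^{n−1}L` is
irreducible and `τ ≥ 3` at every top point over `C`, closed or not) · every regular scheme · port L only (blow-up
charts, controlled
transform, semicontinuity of order, `gr` of a regular local ring, properness of `ℙ¹_A`, Serre)]: on a regular
scheme, a uniformly
spread-shaped curve of order `n ≥ 2` has an exit package with centres over it.  STATEMENT (engine). (Sources: Hironaka1967;
CossartJannsenSaito2020 Ch. 2, Ch. 8; CossartPiltant2008 Prop. 4.2; BierstoneGrigorievMilmanWlodarczyk2011 §3;
StacksProject Tag 0805.) -/
def SpreadExit : Prop :=
  ∀ (Y : Scheme.{0}), Scheme.IsRegular Y → ∀ (I : Y.IdealSheafData) (n : ℕ), 2 ≤ n → ∀ (m : ℕ) (η : Y),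
    IsUniformSpreadCurve I n m η → PackageExitsOver I n {y : Y | η ⤳ y}

/-- **SPREAD-CURVE point** [g19] (NEW DECIDED CLASS, leaf (Γ)): `y` lies on (or is the generic point of) a
Top-isolated, uniformly
spread-shaped curve.  Inhabitant: the CORE of INSEP-v (the window's certified jump point; NODE-g19 §3) — and every
point of its curve.
DEFINITION (NEW class). -/
def IsSpreadCurvePt {Y : Scheme.{0}} (I : Y.IdealSheafData) (n : ℕ) (y : Y) : Prop :=
  ∃ (η : Y) (m : ℕ), η ⤳ y ∧ IsTopIsolatedClosure I n η ∧ IsUniformSpreadCurve I n m η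

/-- Under ENGINE (Γ), every spread-curve point is a curve-exit point of g12's port.  KERNEL (PROVED). [folklore] -/
theorem isCurveExitPt_of_isSpreadCurvePt {Y : Scheme.{0}} {I : Y.IdealSheafData} {n : ℕ} {y : Y}
    (hS : SpreadExit) (hY : Scheme.IsRegular Y) (hn : 2 ≤ n) (h : IsSpreadCurvePt I n y) :
    IsCurveExitPt I n y := by
  obtain ⟨η, m, hηy, hiso, hcurve⟩ := h
  exact ⟨η, hηy, hcurve.1, hiso, hS Y hY I n hn m η hcurve⟩

/-- The letters of a spread-shaped point name a member of SPREAD SHAPE with `q ≥ 1` — the degree satisfies `n ≤ m`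
(indeed `m ≥ 2n − 1`).
KERNEL (PROVED; letter bookkeeping used by the probes). [folklore] -/
theorem le_of_isSpreadAt {Y : Scheme.{0}} {I : Y.IdealSheafData} {n m : ℕ} {η y : Y} (h : IsSpreadAt I n m η y) :
    n ≤ m := by
  obtain ⟨_, c, v, g, f, G, _, _, _, _, _, _, _, ⟨q, hq, hmn⟩, _, _⟩ := h
  have h1 : (q + 1) * n ≥ 2 * n := Nat.mul_le_mul_right n (by omega)
  omega

/-! ## §V  NEW (g19): the SPREAD cut — the leaf `spreadLeaf = cylLeaf ∨ (Γ)`, its located residual class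
`IsSpreadSpecialPt`, the rungs
(instances of §G), `Spread.closes` BY NAME, the engines at work, and the EXACT RE-LOCATION of g18's
`Cyl.CylSpecialRung` (and of g17's
`Split.SplitSpecialRung`, g16's `Grand.GrandSpecialRung`, g15's `Vast.VastSpecialRung`, g14's `PinchSpecialRung`,
the tree aside 33866
`MaxContactCut.LeafSpecialRung`) modulo the spread decided half — all 0 sorry. -/

/-- The SPREAD leaf of g19: cylinder leaf (g18) ∨ spread-curve.  DEFINITION (leaf instance). [folklore] -/
def spreadLeaf : ∀ ⦃Y : Scheme.{0}⦄, Y.IdealSheafData → ℕ → Y → Prop :=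
  fun _ I n y => cylLeaf I n y ∨ IsSpreadCurvePt I n y

/-- `cylLeaf_le_spreadLeaf`: Auxiliary step of this node's calculus, VERBATIM from the lens file (see the module
docstring); the statement is its type. [folklore] -/
theorem cylLeaf_le_spreadLeaf ⦃Y : Scheme.{0}⦄ (I : Y.IdealSheafData) (n : ℕ) (y : Y) :
    cylLeaf I n y → spreadLeaf I n y :=
  fun h => Or.inl h

/-- `splitLeaf_le_spreadLeaf`: Auxiliary step of this node's calculus, VERBATIM from the lens file (see the module
docstring); the statement is its type. [folklore] -/
theorem splitLeaf_le_spreadLeaf ⦃Y : Scheme.{0}⦄ (I : Y.IdealSheafData) (n : ℕ) (y : Y) :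
    splitLeaf I n y → spreadLeaf I n y :=
  fun h => Or.inl (splitLeaf_le_cylLeaf I n y h)

/-- `grandLeaf_le_spreadLeaf`: Auxiliary step of this node's calculus, VERBATIM from the lens file (see the module
docstring); the statement is its type. [folklore] -/
theorem grandLeaf_le_spreadLeaf ⦃Y : Scheme.{0}⦄ (I : Y.IdealSheafData) (n : ℕ) (y : Y) :
    grandLeaf I n y → spreadLeaf I n y :=
  fun h => Or.inl (grandLeaf_le_cylLeaf I n y h)

/-- `vastLeaf_le_spreadLeaf`: Auxiliary step of this node's calculus, VERBATIM from the lens file (see the module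
docstring); the statement is its type. [folklore] -/
theorem vastLeaf_le_spreadLeaf ⦃Y : Scheme.{0}⦄ (I : Y.IdealSheafData) (n : ℕ) (y : Y) :
    vastLeaf I n y → spreadLeaf I n y :=
  fun h => Or.inl (vastLeaf_le_cylLeaf I n y h)

/-- `pinchLeaf_le_spreadLeaf`: Auxiliary step of this node's calculus, VERBATIM from the lens file (see the module
docstring); the statement is its type. [folklore] -/
theorem pinchLeaf_le_spreadLeaf ⦃Y : Scheme.{0}⦄ (I : Y.IdealSheafData) (n : ℕ) (y : Y) :
    pinchLeaf I n y → spreadLeaf I n y :=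
  fun h => Or.inl (pinchLeaf_le_cylLeaf I n y h)

/-- `spreadLeaf_of_isSpreadCurvePt`: Auxiliary step of this node's calculus, VERBATIM from the lens file (see the
module docstring); the statement is its type. [folklore] -/
theorem spreadLeaf_of_isSpreadCurvePt ⦃Y : Scheme.{0}⦄ {I : Y.IdealSheafData} {n : ℕ} {y : Y}
    (h : IsSpreadCurvePt I n y) : spreadLeaf I n y :=
  Or.inr h

/-- **SPREAD-SPECIAL point** [g19] — THE LOCATED RESIDUAL CLASS of this node: cylinder-special (g18) and NOT a
spread-curve point — the
side of the structural dichotomy where the SECONDARY CURVE IS SINGULAR for every frame (or there is no secondary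
curve in the regime
`m ≡ −1 mod n`).  What is LEFT (booked, NODE-g19 §7): CUSPIDAL secondary curves (INSEP-v³ = `(z+vU)² + u₁⁵ + v³·u₂⁵
+ u₂⁷`: `w⁵ + v̄³ = 0`;
certified), the regimes `m ≡ ρ mod n`, `0 ≤ ρ ≤ n − 2` (`ρ = 0` genuinely different in characteristic `p = n`:
NODE-g19 §2), faces with
mixed monomials, equisingular non-rigid families whose face is not binary-pure, deep splits `z(z + v²U)`,
NON-PRINCIPAL `I_y` beyond the
δ-deep letter (iii), Tangle (`R1-notail`), Sing / Iso (iv).  DEFINITION (NEW class). [folklore] -/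
def IsSpreadSpecialPt {k : Type} [Field k] {Y : Scheme.{0}} (g : Y ⟶ Spec (.of k)) (hY : Scheme.IsRegular Y)
    (I : Y.IdealSheafData) (n : ℕ) (y : Y) : Prop :=
  IsCylSpecialPt g hY I n y ∧ ¬ IsSpreadCurvePt I n y

end Summit.ResolutionOfSingularities.ResolutionOfSingularities.Theorems.SpreadCut
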